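import Mathlib
import HarnessLib
import HarnessLib.Audit
import Summits.KontsevichZagierPeriods.Statement
import HarnessLib.Audit.Status.Attr

/-!
Route: MultivaluedCoV

# Route MultivaluedCoV — KontsevichZagierPeriods (plancard 2026-08-15; idea card
correspondences-as-multivalued-cov)

## Thesis X (it suffices to show X)
Words: enlarge the fixed H21 calculus by ONE derived move — MULTIVALUED CHANGE OF VARIABLES along a
finite-sheeted
ℚ-semialgebraic correspondence: sheets (σ_k, Φ_k), k < N, each Φ_k injective and differentiable on
σ_k with co-null image
in τ, acting by the relator [σ, Σ_k 1_{σ_k}·(g∘Φ_k)·|det Φ_k'|] − N·[τ, g] ("transfer = trace along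
the correspondence";
N = 1 is rule 2)). X := (T) SheetTransfer: every such relator already lies in KZ.relations (derived
rule: null-set and domain
additivity + N changes of variables + integrand additivity), AND (K) MultiCoVKernel: the kernel
conjecture for the enlarged
calculus KZ⁺ — every c with KZ.eval c = 0 lies in the subgroup generated by moves (1a), (1b), (3)
and the multivalued-CoV
relators.
Lean (both decls elaborate; folder Sketch.lean rc 0): X = `SheetTransfer ∧ MultiCoVKernel`; Assembly
`SheetTransfer → MultiCoVKernel → KontsevichZagierPeriods` is PROVED in the sketch
(AddSubgroup.closure_le with
KZ.domainAddRel_subset_relations, KZ.integrandAddRel_subset_relations,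
KZ.newtonLeibnizRel_subset_relations and T, then
Summit.KontsevichZagierPeriods.KernelForm.kontsevichZagierPeriods_of_kzKernelConjecture).
Honesty clause: modulo (T), (K) is equivalent to
Literature.NumberTheory.Transcendental.KZKernelConjecture (a rule-2)
instance is the 1-sheet relator), so the GPC-strength core is NOT reduced by this route; what it
adds is the ENGINE (T) and the
RUNGS below — which classical "miraculous substitutions" are literally one (multivalued) move:
algebraic GROUP LAWS, ISOGENIES
and CM/Fermat CORRESPONDENCES read through the uniformisation.

## Two-layer plan (crux statements first, glue later)
rank 2  EllipticAreaCoV (crux) — the addition law of y² = P(x) = 4x³ − g₂x − g₃ (g₂, g₃ ∈ ℚ, three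
real roots) is ONE
        changeOfVariablesRel instance: Φ(s,t) = ℘(℘⁻¹(s) − i℘⁻¹(t)) = (−s−t+(P(s)+P(t))/(4(s−t)²),
√(−P(s)P(t))/(2(s−t)²))
        maps (s beyond the largest root) × (t below the smallest root), integrand 1/√(−P(s)P(t)),
bijectively onto the open
        upper half-plane, integrand 1/|P(u+iv)|, with |det Φ'| = |P(Φ)|/√(−P(s)P(t)) (translation
invariance of dx/y).
        This is Riemann's bilinear relation (i/2)∫_E ω∧ω̄ = |ω₁||ω₂| for real rectangular lattices
as a single move —
        the first genus-1 derivation in the tree.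
rank 3  TriplicationAccessible (crux, SHARED with Neg 0312 / ExpConservative 0544) — the CM/Fermat
rung: Gauss triplication
        B(1/9,4/9)B(5/9,7/9) = 2·3^{7/6}π through the degree-9 Fermat correspondence (x ↦ x³ sheets;
Koblitz–Ogus/Aoki) + T.
rank 4  TwoIsogenySheets (crux) — the 2-isogeny x ↦ x + a + b/x (Silverman AEC III.4.5) presents
[ℝ², 1/|x³+ax²+bx|] as a
        TWO-sheeted cover (sheets |x|² > |b| and 0 < |x|² < |b|) of [ℝ², 1/|X³ − 2aX² + (a²−4b)X|]:
the genuinely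
        multivalued instance, all data over ℚ.
rank 5  SheetTransfer (crux; the engine T) — derived rule over the PROVED semialgebraic toolkit
(add/mul/comp/image *_holds).
rank 0  MultiCoVKernel (target K); rank 1 Assembly (proved in sketch).
support EllipticAreaIdentity ([ℝ², 1/|P|] − 2·[R, 1/√(−P(s)P(t))] ∈ relations),
TwoIsogenyAreaIdentity ([ℝ², 1/|P|] −
        2·[ℝ², 1/|Q|] ∈ relations), LandenIsogenyCoV (Newman's x = (t − ab/t)/2: the real
2-isogeny/AGM step is ONE rule-2)
        instance with all data in ℚ).
Glue later (tenure): split EllipticAreaCoV into Jacobian identity / bijectivity if a prover stalls;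
RationalMapTransfer (every
degree-d map in ℚ(x) acts as a d-valued CoV on plane reps) once TwoIsogenySheets lands; Fermat x ↦
x³ sheet family for 0312
after T lands.

Rationale: WHY THIS LINE. At special fibres the extra period relations are algebraic cycles, and the cycles
that act on INTEGRANDS are
correspondences; a finite correspondence acts on KZ representations as a sum over its Nash sheets of
injective semialgebraic
changes of variables, so transfer/trace is NATIVE to the rules (KontsevichZagier2001 §1.2, pp. 8–9,
already rewrote Calabi's
ζ(2) substitution — the circle group law — inside rules 1)–3); the ladder continues: elliptic group
law, isogenies, CM/Fermat).
Imported area: arithmetic geometry of elliptic curves (addition law, isogenies, invariant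
differential: SilvermanAEC2009
III.4–III.5; ℘ on the quarter rectangle: Lawden1989 §6.11–6.12, WhittakerWatson1927 ch. 20) and
Fermat cycles
(Deligne1982HodgeCycles §7, Aoki1987, Shioda1979). Catalogue entry used: geometric/motivic lift WITH
explicit dictionary
(correspondence ↦ sheet family (σ_k, Φ_k); degree ↦ multiplicity N; pullback of ω∧ω̄ ↦ Jacobian |det
Φ'| = |P(Φ)|/√(−P(s)P(t))).
Numerics (folder num/): Jacobian identity to 1e−10; ∫_H dA/|P| = (∫ds/√P)(∫dt/√(−P)) to 4e−4 for
(g₂,g₃) = (4,0),(4,−1);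
∫dA/|x³+ax²+bx| = 2∫dA/|X³−2aX²+(a²−4b)X| to 2e−3 for three (a,b); Newman's identity to 1e−16.
RANKED CRUXES. 2 EllipticAreaCoV (one-move claim; hardest genuinely new derivation; the image must
be EXACTLY the open upper
half-plane). 3 TriplicationAccessible (shared stmt-0312; settles Neg's bet on Γ-detours). 4
TwoIsogenySheets (first
multiplicity-2 transfer, all data over ℚ). 5 SheetTransfer (engine; the "C1" that cards
terasoma-covering,
riemann-bilinear-unnesting, k2-steinberg (S4), isogeny-certificates and integrate-over-the-cycle all
invoke).
Target MultiCoVKernel (GPC-strength; = KZKernelConjecture modulo crux 5 — stated openly). Assembly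
proved in Sketch.lean.
KILL CRITERIA. Refuting EllipticAreaCoV AS A ONE-MOVE claim only downgrades the rung to
EllipticAreaIdentity (a chain);
refuting EllipticAreaIdentity, TwoIsogenyAreaIdentity or SheetTransfer (values certified equal)
refutes the SUMMIT — report to
the operator (calculus defect), close this route refuted and hand the witness to Neg 0313. If 0312
is refuted (Neg 0311 proved)
the CM rung and the special-fibre thesis die: close refuted:TriplicationAccessible unless the
witness is Γ-specific.
NOT DECOMPOSED YET. Non-rectangular lattices (Δ < 0); Legendre/η-type relations (NOT
correspondence-induced — η is not
translation invariant; designated failure probe, owned by cards integrate-over-the-cycle /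
unfolding-abelian-integrals);
RationalMapTransfer in general; the Fermat x ↦ x³ sheet family for 0312 (Koblitz–Ogus appendix to
Deligne, the printed
elementary route, not held); KZ's Mahler 16-vs-5 exercise (card k2-steinberg-calculus-mahler-boyd
owns it); motivic completeness
of correspondence relators for pure motives (not statable in the tree). Items whose only failure
mode is the summit's say so.
Sources: KontsevichZagier2001; SilvermanAEC2009; Lawden1989; WhittakerWatson1927;
Deligne1982HodgeCycles; Aoki1987; Shioda1979;
BeukersCalabiKolk1993; HuberWustholz2022; CressonViusos2022; arXiv:math/0612007;
doi:10.1007/978-1-4757-2736-4_57 (Newman 1985).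

Novelty: NOVELTY (search-before-claim 2026-08-15). The CARD was audited new-combination
(refuter-novelty-audit-2-0: zbMATH/crossref/held
texts; rung 0 printed in KontsevichZagier2001 pp. 8-9). This session added: lit search --hybrid
"Weierstrass function maps
rectangle conformally onto half-plane period parallelogram area" (8 textbook hits;
book:lawden1989-elliptic-functions-applications
§6.11-6.12 READ p0170-p0171: ℘ real and monotone on the quarter-rectangle boundary, conjugate values
on the conjugate rectangle —
the classical input, no rules reading, no area identity); lit search --hybrid "Calabi change of
variables zeta(2) Kontsevich Zagier
rules" (paper:arxiv-1407.2388; paper:url-4812d7ce6862 = KontsevichZagier2001 pp. 9-10 READ: Calabi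
inside rules 1)-3) PRINTED,
Mahler 16-vs-5 posed as an exercise); crossref "Newman simplified version of the fast algorithms of
Brent and Salamin"
(doi:10.1007/978-1-4757-2736-4_57: the substitution x = (t - ab/t)/2 proving AGM/Landen invariance
in one line — KNOWN, filed
only as the support/calibration item LandenIsogenyCoV); lean search Weierstrass (tree: ℘, addition
theorems, segment lifts in
Literature/NumberTheory/EllipticCurves/ComplexTorus*.lean and Transcendental/KZEllipticChain.lean
prove lattice vectors ARE KZ
periods; no ω∧ω̄/area identity, no transfer rule, no isogeny action on representations). Nearest
prior art: KontsevichZagier2001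
§1.2 pp. 8-9 (rung 0); BeukersCalabiKolk1993; arXiv:math/0612007 (Lalín-Rogers, isogeny functional
equ  [refs: 10.1007/978-1-4757-2736-4_57:, math/0612007, 1912.01751, book:lawden1989-elliptic-functions-applications, paper:arxiv-1407.2388, paper:url-4812d7ce6862, doi:10.1007/978-1-4757-2736-4_57, KontsevichZagier2001, BeukersCalabiKolk1993, SilvermanAEC2009, Lawden1989]

Barriers (technique_class: correspondence-sheet-transfer; group-law-cov): technique_class: correspondence-sheet-transfer; group-law-cov
- Literature.Barriers.KontsevichZagierPeriods.noSemialgebraicPrimitive_inv_sub_two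
[primitive-elimination]: evaded — no item
  integrates out a variable or uses rule 3) with a primitive; every rung is rule 2) (single- or
multivalued) plus null-set,
  domain and integrand additivity; the only primitives foreseen (Fermat rung 0312) are algebraic
monomials x^s(1−x)^t.
- Literature.Barriers.KontsevichZagierPeriods.cressonViuSos_prop_3_2 [one global semialgebraic map
WITHOUT dissection]:
  respected — SheetTransfer dissects the source into sheets σ_k and discards null sets BEFORE
mapping (scissors kept);
  EllipticAreaCoV / LandenIsogenyCoV are single global maps, but between open cells (open rectangle
→ open half-plane,
  (0,∞) → ℝ) in dimension ≤ 2, where the Hauptvermutung hypothesis (compact polyhedra,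
homeomorphic-not-PL, dim ≥ 5) is vacuous.
- Literature.Barriers.KontsevichZagierPeriods.kzConjecture_implies_ellipticPeriods_algIndep,
  Literature.Barriers.KontsevichZagierPeriods.kzConjecture_implies_oddZetaAlgIndep,
  Literature.Barriers.KontsevichZagierPeriods.kzConjecture_implies_twoPiI_log_algIndep [strength
barriers, all techniques]:
  they bite ONLY the target MultiCoVKernel (GPC-strength, equivalent to KZKernelConjecture modulo
SheetTransfer — said
  openly in the thesis); every crux/support item is an unconditional derived-rule or accessibility
statement about specific
  equal-valued representations and prov

Novelty grade: new-combination — ROUTE REVIEW (refuter …-c59626b6-g2-0, 2026-08-15; third concurring pass after a258b335-0 and c59626b6-0): KEEP OPEN. 9/9 elaborate, 0 refuted/vacuous/trivial; Assembly 2874 proved (AssemblyProof + KZAssembly.lean, which also proves the converse KZKernelConjecture → MultiCoVKernel). Conforming shape (refuter refuter-rreview-route-KontsevichZagierPe-c59626b6-g2-0, 2026-08-15T14:05:54Z; prior: KontsevichZagier2001 §1.2 pp.8-9 (Calabi/circle group law inside rules 1-3), Newman1985 doi:10.1007/978-1-4757-2736-4_57 (Landen step by one rational substitution), LalinRogers arXiv:math/0612007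 (isogeny functional equations), BeukersCalabiKolk1993, Lawden1989 §6.11-6.12, SilvermanAEC2009 III.4.5/III.5, route-KontsevichZagierPeriods-IsogenyCertificates (open sibling, dim-1 transfer), route-Kontse)

History (route lifecycle, newest last):
- 2026-08-16T02:17:41Z · AUTO-CRUX: 1 conjecture-grade item(s) promoted to crux (MultiCoVKernel) — refuter vetting / tiering apply (operator:999:1362873)
- 2026-08-16T04:09:17Z · AUTO-CRUX (backfill): MultiCoVKernel — hypotheses of the deciding theorem that nothing in the route derives are cruxes (operator:999:1085951)
- 2026-08-23T22:00:44Z · DORMANT — reconciler: no traction for 6.3 d (last activity item-evidence-added at 2026-08-17T14:41:05Z); parked, not closed — `ledger route dormant route-KontsevichZagier (operator:999:1179595)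
- 2026-08-30T03:39:47Z · REACTIVATED — reconciler: reactivated — activity statement-attached at 2026-08-30T02:51:58Z after parking at 2026-08-23T22:00:44Z (operator:999:4134712)

sub-problem: KontsevichZagierPeriods · status: open · opened planner-plancard-KontsevichZagierPeriods-Kont-43c92222-0 2026-08-15T11:09:10Z · rev 2 · ledger route-KontsevichZagierPeriods-MultivaluedCoV
GENERATED by the gate from the ledger (D-0016/17). Provers cite these decls: `theorem foo : Summit.KontsevichZagierPeriods.KontsevichZagierPeriods.Theses.MultivaluedCoV.<Decl> := …` in Summits/KontsevichZagierPeriods/KontsevichZagierPeriods/Theorems/<Name>.lean.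
-/

namespace Summit.KontsevichZagierPeriods.KontsevichZagierPeriods.Theses.MultivaluedCoV

open scoped BigOperators Topology Manifold Classical MeasureTheory ProbabilityTheory Matrix InnerProductSpace ComplexConjugate ContinuousMap
open Filter Set Function TopologicalSpace MeasureTheory

attribute [summit_statement] _root_.KontsevichZagierPeriods

open Literature Periods

/-- item stmt-KontsevichZagierPeriods-2873 · crux (kind.auto-crux: conjecture-grade) · rank 0 · open · by planner
why it might fail: GPC-strength: equivalent to KZKernelConjecture modulo SheetTransfer; false iff some equal-valued pair is underivable (Neg 0311's bet: Gauss-triplication pair; regularised MZV relations).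
sources: KontsevichZagier2001, HuberMullerStach2017, HuberWustholz2022
[target] Kernel conjecture of the ENLARGED calculus KZ⁺: every formal ℤ-combination with value 0 is
generated by domain additivity (1a), integrand additivity (1b), Newton–Leibniz (3) and the
multivalued change-of-variables relators [σ, Σ_k 1_{σ_k}(g∘Φ_k)|det Φ_k'|] − N·[τ, g] of
finite-sheeted ℚ-semialgebraic correspondences (sheets injective, differentiable, co-null images).
Honest status: modulo SheetTransfer it is EQUIVALENT to
Literature.NumberTheory.Transcendental.KZKernelConjecture (a rule-2) instance is the 1-sheet
relator), hence GPC-strength (strength barriers bite here and only here). Filed so that the engine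
is load-bearing in the Assembly and KZ⁺ is on record as a formal object. -/
@[route_item "route-KontsevichZagierPeriods-MultivaluedCoV", crux]
def MultiCoVKernel : Prop :=
  ∀ c : Literature.NumberTheory.Transcendental.KZ.FormalRep, Literature.NumberTheory.Transcendental.KZ.eval c = 0 → c ∈ AddSubgroup.closure (Literature.NumberTheory.Transcendental.KZ.domainAddRel ∪ Literature.NumberTheory.Transcendental.KZ.integrandAddRel ∪ Literature.NumberTheory.Transcendental.KZ.newtonLeibnizRel ∪ {c | ∃ (n N : ℕ) (r r' : Literature.NumberTheory.Transcendental.KZ.IntegralRep n) (σ : Fin N → Set (Fin n → ℝ)) (Φ : Fin N → (Fin n → ℝ) → (Fin n → ℝ)) (Φ' : Fin N → (Fin n → ℝ) → ((Fin n → ℝ) →L[ℝ] (Fin n → ℝ))), (∀ k, Literature.ModelTheory.ExponentialFields.IsSemialgebraic ℚ (σ k)) ∧ (∀ k, σ k ⊆ r.domain) ∧ MeasureTheory.volume (r.domain \ ⋃ k, σ k) = 0 ∧ (∀ k, Literature.NumberTheory.Transcendental.IsSemialgebraicMapOn ℚ (σ k) (Φ k)) ∧ (∀ k, ∀ x ∈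 σ k, HasFDerivWithinAt (Φ k) (Φ' k x) (σ k) x) ∧ (∀ k, Set.InjOn (Φ k) (σ k)) ∧ (∀ k, Φ k '' σ k ⊆ r'.domain) ∧ (∀ k, MeasureTheory.volume (r'.domain \ Φ k '' σ k) = 0) ∧ (∀ x ∈ ⋃ k, σ k, r.integrand x = ∑ k : Fin N, (σ k).indicator (fun y => r'.integrand (Φ k y) * |(Φ' k y).det|) x) ∧ c = Literature.NumberTheory.Transcendental.KZ.of r - N • Literature.NumberTheory.Transcendental.KZ.of r'})

/-- item stmt-KontsevichZagierPeriods-2875 · crux · rank 2 · closed · proved by Summit.KontsevichZagierPeriods.MultivaluedCoV.EllipticArea.ellipticAreaCoV_proof @ f0d32277e347 (prover) · by planner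
why it might fail: One-move claim: needs Φ''R = open upper half-plane EXACTLY and InjOn via ℘ on the quarter rectangle; a branch/sign slip (v>0 picks ℘(α−β), not ℘(α+β)) or a boundary point in the image kills membership in changeOfVariablesRel though the chain form (EllipticAreaIdentity) survives.
sources: Lawden1989, WhittakerWatson1927, SilvermanAEC2009, KontsevichZagier2001
[crux] THE GROUP LAW IS ONE CHANGE OF VARIABLES. P(x) = 4x³ − g₂x − g₃, g₂,g₃ ∈ ℚ, g₂³ − 27g₃² > 0
(three real roots e_min < e_mid < e_max; the domain literals say s > e_max, t < e_min through P(s)>0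
∧ P'(s)>0 ∧ s>0, P(t)<0 ∧ P'(t)>0 ∧ t<0 — checked equivalent numerically). Claim: [R,
1/√(−P(s)P(t))] − [H, 1/|P(u+iv)|] ∈ changeOfVariablesRel, H = open upper half-plane, via Φ(s,t) =
(u,v), u = −s − t + (P(s)+P(t))/(4(s−t)²), v = √(−P(s)P(t))/(2(s−t)²): the addition formula ℘(α−β)
with ℘(α) = s on the real half-period segment and ℘(β) = t on the imaginary one, so Φ = ℘ on the
open quarter rectangle = a bijection onto the open half-plane (Lawden1989 §6.11: ℘ real and monotone
on the boundary, conjugate values on the conjugate rectangle; WhittakerWatson1927 ch. 20); |det Φ'|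
= |P(Φ(s,t))|/√(−P(s)P(t)) is translation invariance of dx/y (SilvermanAEC2009 III.5) and was
certified numerically to 1e−10, and ∫_H dA/|P| = (∫_{e_max}^∞ ds/√P)(∫_{−∞}^{e_min} dt/√(−P)) to
4e−4 for (g₂,g₃) = (4,0), (4,−1) (planner folder num/). Meaning: Riemann's bilinear relation
(i/2)∫_E ω∧ω̄ = |ω₁||ω₂| for the rectangular lattice as ONE move. Prover resources: the tree's ℘
(Literature/NumberTheory/EllipticCurv -/
@[route_item "route-KontsevichZagierPeriods-MultivaluedCoV"]
def EllipticAreaCoV : Prop :=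
  ∀ g₂ g₃ : ℚ, 0 < g₂ ^ 3 - 27 * g₃ ^ 2 → ∀ (r r' : Literature.NumberTheory.Transcendental.KZ.IntegralRep 2), r.domain = {z : Fin 2 → ℝ | 0 < 4 * z 0 ^ 3 - (g₂ : ℝ) * z 0 - g₃ ∧ 0 < 12 * z 0 ^ 2 - (g₂ : ℝ) ∧ 0 < z 0 ∧ 4 * z 1 ^ 3 - (g₂ : ℝ) * z 1 - g₃ < 0 ∧ 0 < 12 * z 1 ^ 2 - (g₂ : ℝ) ∧ z 1 < 0} → Set.EqOn r.integrand (fun z => 1 / Real.sqrt (-((4 * z 0 ^ 3 - (g₂ : ℝ) * z 0 - g₃) * (4 * z 1 ^ 3 - (g₂ : ℝ) * z 1 - g₃)))) r.domain → r'.domain = {w : Fin 2 → ℝ | 0 < w 1} → Set.EqOn r'.integrand (fun w => 1 / ‖4 * ((w 0 : ℂ) + (w 1 : ℂ) * Complex.I) ^ 3 - (g₂ : ℂ) * ((w 0 : ℂ) + (w 1 : ℂ) * Complex.I) - (g₃ : ℂ)‖) r'.domain → Literature.NumberTheory.Transcendental.KZ.of r - Literature.NumberTheory.Transcendental.KZ.of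 r' ∈ Literature.NumberTheory.Transcendental.KZ.changeOfVariablesRel

-- `EllipticAreaCoV` holds: proved by `Summit.KontsevichZagierPeriods.MultivaluedCoV.EllipticArea.ellipticAreaCoV_proof` @ f0d32277e347 (its module imports this route file, so no `_holds` link can be stated here).

/-- item stmt-KontsevichZagierPeriods-0312 · crux · rank 3 · open · by planner
why it might fail: May need a cycle acting through Poincaré duality rather than a finite correspondence on integrands (Aoki's cycles for 3|m are not of graph type), leaving only Γ/regulator proofs; then Neg 0311 (its negation) is the live bet. Values agree to 1e−11.
sources: Deligne1982HodgeCycles, Aoki1987, Shioda1979, Waldschmidt2006, KontsevichZagier2001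
Positive form of #2. A proof must avoid Γ: candidate strategy = realise the degree-9 Fermat-curve
correspondence behind the identity as semialgebraic changes of variables between (blow-ups of)
(0,1)² pieces plus Newton–Leibniz with algebraic primitives (Rohrlich/Deligne distribution relations
are induced by the maps x ↦ x³ on Fermat curves — algebraic, finite ⇒ CoV on injectivity cells). If
found, pressure point (b) of route Neg dies at its first instance. [elaborates: yes:
_survey/SketchB.lean; sources: Deligne1982HodgeCycles, KontsevichZagier2001] -/
@[route_item "route-KontsevichZagierPeriods-MultivaluedCoV"]
def TriplicationAccessible : Prop :=
  ∀ (r r' : Literature.NumberTheory.Transcendental.KZ.IntegralRep 2), r.domain = {x | ∀ i, x i ∈ Set.Ioo (0:ℝ) 1} → Set.EqOn r.integrand (fun x => (x 0) ^ (-(8:ℝ)/9) * (1 - x 0) ^ (-(5:ℝ)/9) * (x 1) ^ (-(4:ℝ)/9) * (1 - x 1) ^ (-(2:ℝ)/9)) r.domain → r'.domain = {x | x 0 ^ 2 + x 1 ^ 2 < 4} → Set.EqOn r'.integrand (fun _ => (3:ℝ) ^ ((7:ℝ)/6) / 2) r'.domain → Literature.NumberTheory.Transcendental.KZ.Equivalent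 r r'

/-- item stmt-KontsevichZagierPeriods-2876 · crux · rank 4 · open · by planner
why it might fail: As typed the witness must meet SheetTransfer's literal hypotheses: HasFDerivWithinAt within each sheet, images co-null in ℝ² and the exact pointwise identity incl. junk values 1/0 = 0 at the 3 roots; a mismatch there (not in the mathematics) falsifies the ∃.
sources: SilvermanAEC2009, KontsevichZagier2001, arXiv:math/0612007
[crux] AN ISOGENY IS A TWO-VALUED CHANGE OF VARIABLES. E: y² = P(x) = x³ + ax² + bx, E': Y² = Q(X) =
X³ − 2aX² + (a²−4b)X, a,b ∈ ℚ, b(a²−4b) ≠ 0; the 2-isogeny φ(x,y) = (y²/x², y(b−x²)/x²)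
(SilvermanAEC2009 III.4.5) has x-part R(x) = x + a + b/x with φ^*(dX/Y) = −dx/y, hence
|R'(x)|²/|Q(R(x))| = 1/|P(x)| pointwise (certified to 1e−14). Claim: the full-plane reps r = [ℝ²,
1/|P(x₀+ix₁)|], r' = [ℝ², 1/|Q|] satisfy the hypotheses of SheetTransfer with N = 2: sheets σ₀ =
{|x|² > |b|}, σ₁ = {0 < |x|² < |b|} (ℚ-semialgebraic; complement = circle ∪ {0}, null), Φ₀ = Φ₁ = R
as a real-rational map, injective on each sheet (R(x) = R(x') iff x' ∈ {x, b/x}), each image = ℂ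
minus R(circle) (a segment: co-null), integrand identity on σ₀ ∪ σ₁ with Lean's 1/0 = 0 conventions
consistent (Q(R x) = 0 on the sheets only where P(x) = 0). With SheetTransfer this yields
TwoIsogenyAreaIdentity ∬dA/|P| = 2∬dA/|Q| (covolume index 2; certified to 2e−3 for (a,b) =
(1,2),(0,−1),(−2,5)). -/
@[route_item "route-KontsevichZagierPeriods-MultivaluedCoV"]
def TwoIsogenySheets : Prop :=
  ∀ a b : ℚ, b ≠ 0 → a ^ 2 - 4 * b ≠ 0 → ∀ (r r' : Literature.NumberTheory.Transcendental.KZ.IntegralRep 2), r.domain = Set.univ → Set.EqOn r.integrand (fun z => 1 / ‖((z 0 : ℂ) + (z 1 : ℂ) * Complex.I) ^ 3 + (a : ℂ) * ((z 0 : ℂ) + (z 1 : ℂ) * Complex.I) ^ 2 + (b : ℂ) * ((z 0 : ℂ) + (z 1 : ℂ) * Complex.I)‖) r.domain → r'.domain = Set.univ → Set.EqOn r'.integrand (fun w => 1 / ‖((w 0 : ℂ) + (w 1 : ℂ) * Complex.I) ^ 3 - 2 * (a : ℂ) * ((w 0 : ℂ) + (w 1 : ℂ) * Complex.I) ^ 2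 + ((a : ℂ) ^ 2 - 4 * (b : ℂ)) * ((w 0 : ℂ) + (w 1 : ℂ) * Complex.I)‖) r'.domain → ∃ (σ : Fin 2 → Set (Fin 2 → ℝ)) (Φ : Fin 2 → (Fin 2 → ℝ) → (Fin 2 → ℝ)) (Φ' : Fin 2 → (Fin 2 → ℝ) → ((Fin 2 → ℝ) →L[ℝ] (Fin 2 → ℝ))), (∀ k, Literature.ModelTheory.ExponentialFields.IsSemialgebraic ℚ (σ k)) ∧ (∀ k, σ k ⊆ r.domain) ∧ MeasureTheory.volume (r.domain \ ⋃ k, σ k) = 0 ∧ (∀ k, Literature.NumberTheory.Transcendental.IsSemialgebraicMapOn ℚ (σ k) (Φ k)) ∧ (∀ k, ∀ x ∈ σ k, HasFDerivWithinAt (Φ k) (Φ' k x) (σ k) x) ∧ (∀ k, Set.InjOn (Φ k) (σ k)) ∧ (∀ k, Φ k '' σ k ⊆ r'.domain) ∧ (∀ k, MeasureTheory.volume (r'.domain \ Φ k '' σ k) = 0) ∧ (∀ x ∈ ⋃ k, σ k, r.integrand x = ∑ k : Fin 2, (σ k).indicator (fun y => r'.integrand (Φ k y) * |(Φ' k y).det|)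 x)

/-- item stmt-KontsevichZagierPeriods-2877 · crux · rank 5 · open · by planner
why it might fail: Value identity is immediate, so underivability would refute the summit itself; the live risk is as-typed: overlapping sheets force intermediate reps Σ_{k<j}1_{σ_k}h_k whose semialgebraicity/integrability must come from proved toolkit lemmas — a missing side condition makes the ∀ false-as-stated.
sources: KontsevichZagier2001, BCR1998, HuberMullerStach2017
[crux] THE ENGINE (card C1; invoked as 'correspondence transfer' by cards terasoma-covering,
riemann-bilinear-unnesting, k2-steinberg (S4), isogeny-certificates, integrate-over-the-cycle).
Data: r, r' in the same dimension n; sheets σ_k ⊆ r.domain (k < N) ℚ-semialgebraic with r.domain ∖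
⋃σ_k null (sheets MAY overlap: branches of one algebraic function over the same σ); maps Φ_k
ℚ-semialgebraic, injective and differentiable (HasFDerivWithinAt within σ_k) on σ_k, images inside
r'.domain and co-null there; integrand identity on ⋃σ_k: r.integrand = Σ_k
1_{σ_k}·(r'.integrand∘Φ_k)·|det Φ_k'|. Conclusion: of r − N • of r' ∈ KZ.relations (∫_σ Σ sheets =
N∫_τ g: the area formula with constant multiplicity). Derivation: [r] = [r|⋃σ] + [r|null]
(domainAddRel; null-domain reps are relations: [z] = [z]+[z]); integrand additivity peels the N
summands (partial sums are IntegralReps: IsSemialgebraicFunOn.add_holds, indicator graphs = graph ∪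
(complement × {0}); each summand integrable by
MeasureTheory.integrableOn_image_iff_integrableOn_abs_det_fderiv_smul from r'.integrableOn); [⋃σ,
1_{σ_k}h_k] = [σ_k, h_k] + [⋃σ∖σ_k, 0]; [σ_k, h_k] − [Φ_k σ_k, g] ∈ changeOfVariablesRel (image
semialgebraic: IsSe -/
@[route_item "route-KontsevichZagierPeriods-MultivaluedCoV", crux]
def SheetTransfer : Prop :=
  ∀ (n N : ℕ) (r r' : Literature.NumberTheory.Transcendental.KZ.IntegralRep n) (σ : Fin N → Set (Fin n → ℝ)) (Φ : Fin N → (Fin n → ℝ) → (Fin n → ℝ)) (Φ' : Fin N → (Fin n → ℝ) → ((Fin n → ℝ) →L[ℝ] (Fin n → ℝ))), (∀ k, Literature.ModelTheory.ExponentialFields.IsSemialgebraic ℚ (σ k)) → (∀ k, σ k ⊆ r.domain) → MeasureTheory.volume (r.domain \ ⋃ k, σ k) = 0 → (∀ k, Literature.NumberTheory.Transcendental.IsSemialgebraicMapOn ℚ (σ k) (Φ k)) → (∀ k, ∀ x ∈ σ k, HasFDerivWithinAt (Φ k) (Φ' k x) (σ k) x) → (∀ k, Set.InjOn (Φ k)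 (σ k)) → (∀ k, Φ k '' σ k ⊆ r'.domain) → (∀ k, MeasureTheory.volume (r'.domain \ Φ k '' σ k) = 0) → (∀ x ∈ ⋃ k, σ k, r.integrand x = ∑ k : Fin N, (σ k).indicator (fun y => r'.integrand (Φ k y) * |(Φ' k y).det|) x) → Literature.NumberTheory.Transcendental.KZ.of r - N • Literature.NumberTheory.Transcendental.KZ.of r' ∈ Literature.NumberTheory.Transcendental.KZ.relations

/-- item stmt-KontsevichZagierPeriods-0541 · crux · rank 6 · open · by planner
why it might fail: Period-conjecture strength (Ayoub2014 Cor. 32, HMS Prop. 13.2.6): with π-cancellation it yields algebraic independence of ζ(3), ζ(5), …; torsor/motivic methods give relations in Nori's/Ayoub's presentation only and their transfer into the four moves (even with [π] inverted) is unproved.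
sources: Ayoub2014, HuberMullerStachPeriods2017, KontsevichZagier2001, HuberWustholz2022
PiLocalKernel := ∀ c : Literature.NumberTheory.Transcendental.KZ.FormalRep,
Literature.NumberTheory.Transcendental.KZ.eval c = 0 → ∃ N : ℕ, (of piRep)^⋆N ⋆ c ∈
Literature.NumberTheory.Transcendental.KZ.relations. This is the half of S reachable by torsor
arguments: Grothendieck's period conjecture gives injectivity of P̃ = P̃^eff[(2πi)⁻¹] → ℂ (route
Grothendieck, 0279), and a transfer of Nori/cohomological relators into KZ.relations (route
NoriTransfer, 0194/0198) then yields (2πi)^{2N}·c = (−4π²)^N·c ∈ relations WITHOUT needing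
injectivity of P̃^eff → P̃; Ayoub's rigid-analytic computation of the Betti–de Rham torsor
(Ayoub2015 §3.6, AyoubRelKZRevisited Thm 1.11) is the model argument and works precisely after
inverting 2πi. Open (≈ GPC-strength); filed so that provers/refuters see the effective/localised
distinction explicitly and so that a proof of #2′ collapses the problem to this item.
[needs_definition: KZ.prodRep / piRep / PiLocalKernel (def request this session); sources:
AyoubRelKZRevisited, Ayoub2015, HuberMullerStach2017] -/
@[route_item "route-KontsevichZagierPeriods-MultivaluedCoV"]
def AyoubPiLocalKernel : Prop :=
  ∀ (P : ∀ n : ℕ, Literature.NumberTheory.Transcendental.KZ.IntegralRep n → Literature.NumberTheory.Transcendental.KZ.IntegralRep (n + 2)), (∀ (n : ℕ) (r : Literature.NumberTheory.Transcendental.KZ.IntegralRep n), (P n r).domain = {z : Fin (n + 2) → ℝ | z 0 ^ 2 + z 1 ^ 2 ≤ 1 ∧ (fun i : Fin n => z i.succ.succ) ∈ r.domain} ∧ (P n r).integrand = fun z => r.integrand (fun i : Fin n => z i.succ.succ)) → ∀ c : Literature.NumberTheory.Transcendental.KZ.FormalRep, Literature.NumberTheory.Transcendental.KZ.eval c = 0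 → ∃ N : ℕ, (⇑(FreeAbelianGroup.lift (fun s : (Σ n, Literature.NumberTheory.Transcendental.KZ.IntegralRep n) => Literature.NumberTheory.Transcendental.KZ.of (P s.1 s.2))))^[N] c ∈ Literature.NumberTheory.Transcendental.KZ.relations

/-- item stmt-KontsevichZagierPeriods-0540 · crux · rank 7 · open · by planner
why it might fail: A certificate for [π]⋆c may mix the two disc coordinates with c's (carrier migration), leaving no shadow certificate for c; the motivic shadow P̃(MM^eff_Nori) → P̃(MM_Nori) injective is printed OPEN (HuberWustholz2022 App. A p. 200); one witness refutes the summit (0542).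
sources: HuberWustholz2022, AyoubRelKZRevisited, KontsevichZagier2001, HuberMullerStachPeriods2017
PiCancellation := ∀ c : Literature.NumberTheory.Transcendental.KZ.FormalRep, (of piRep) ⋆ c ∈
Literature.NumberTheory.Transcendental.KZ.relations → c ∈
Literature.NumberTheory.Transcendental.KZ.relations, piRep = closed unit disc with integrand 1 (d =
2). A consequence of S (eval (piRep ⋆ c) = π · eval c by Fubini, π ≠ 0), but transcendence-free: it
is a regular-element property of the presented abelian group FormalRep/relations under the product,
and the exact point where Ayoub's relative theorem fails to be effective (AyoubRelKZRevisited Rem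
1.3: the torsor exists only over D((2πi)⁻¹)) and where HuberMullerStach2017 §13 passes from P^eff to
P = P^eff[(2πi)⁻¹]. Independent of the chosen π-representation once `relations` is an ideal under ⋆
(part of the def request). Attack suggestions: (i) normal forms for ⋆-multiples of disc reps (the
disc factor occupies two leading coordinates untouched by NL along the last coordinate; CoV may mix
them — the crux is whether a relation certificate for piRep ⋆ c can be 'projected' to one for c,
e.g. by restricting/fibrewise-specialising the disc coordinates at a rational point and using domain
additivity); (ii) small cases: c supported in dimensi -/
@[route_item "route-KontsevichZagierPeriods-MultivaluedCoV"]
def AyoubPiCancellation : Prop :=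
  ∀ (P : ∀ n : ℕ, Literature.NumberTheory.Transcendental.KZ.IntegralRep n → Literature.NumberTheory.Transcendental.KZ.IntegralRep (n + 2)), (∀ (n : ℕ) (r : Literature.NumberTheory.Transcendental.KZ.IntegralRep n), (P n r).domain = {z : Fin (n + 2) → ℝ | z 0 ^ 2 + z 1 ^ 2 ≤ 1 ∧ (fun i : Fin n => z i.succ.succ) ∈ r.domain} ∧ (P n r).integrand = fun z => r.integrand (fun i : Fin n => z i.succ.succ)) → ∀ c : Literature.NumberTheory.Transcendental.KZ.FormalRep, FreeAbelianGroup.lift (fun s : (Σ n, Literature.NumberTheory.Transcendental.KZ.IntegralRep n) => Literature.NumberTheory.Transcendental.KZ.of (P s.1 s.2)) c ∈ Literature.NumberTheory.Transcendental.KZ.relations → c ∈ Literature.NumberTheory.Transcendental.KZ.relations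

/-- item stmt-KontsevichZagierPeriods-17833 · support · rank 9 · closed · proved by Summit.KontsevichZagierPeriods.MultivaluedCoV.multiCoVKernelSplitGlue_proof @ 91f88586dd54 (prover) · by planner
sources: KontsevichZagier2001, Ayoub2014, HuberWustholz2022
[support] GLUE of the crux-strategist's [π]-localisation split of the deciding crux MultiCoVKernel
(stmt-2873; RESTATED re-audit): AyoubPiLocalKernel (= item 0541) → AyoubPiCancellation (= item 0540)
→ MultiCoVKernel. PROVABLE NOW — proof = strategist folder Split.lean, theorem
`Summit.KontsevichZagierPeriods.MultivaluedCoV.MultiCoVKernelSplit.MultiCoVKernel_of_subs` (rc 0, 0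
sorry, axioms propext/Classical.choice/Quot.sound; attached as evidence on stmt-2873 and published
as Cruxes/MultiCoVKernel/Split.lean): a pinned product exists (`exists_pinnedProduct`,
Theorems/HurwitzMicroSectorsNormalFormPrincipleSplitGlue), π-local kernel gives (lift (of∘P))^[N] c
∈ KZ.relations for c ∈ ker eval, π-cancellation peels the N factors (induction on N,
`Function.iterate_succ_apply'`), and KZ.relations ≤ closure((1a) ∪ (1b) ∪ (3) ∪ multivalued-CoV
relators) because rule (2) is the ONE-SHEET multivalued change of variables
(`changeOfVariablesRel_subset_multiCoVRel`: N = 1, σ₀ = r.domain, the ten side conditions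
discharged). A prover closes this item with `unfold MultiCoVKernelSplitGlue AyoubPiLocalKernel
AyoubPiCancellation; exact MultiCoVKernelSplit.MultiCoVKernel_of_subs` (bodies byte-identical -/
@[route_item "route-KontsevichZagierPeriods-MultivaluedCoV"]
def MultiCoVKernelSplitGlue : Prop :=
  AyoubPiLocalKernel → AyoubPiCancellation → MultiCoVKernel

-- `MultiCoVKernelSplitGlue` holds: proved by `Summit.KontsevichZagierPeriods.MultivaluedCoV.multiCoVKernelSplitGlue_proof` @ 91f88586dd54 (its module imports this route file, so no `_holds` link can be stated here).

/-- item stmt-KontsevichZagierPeriods-2878 · support · rank 9 · closed · proved by Summit.KontsevichZagierPeriods.MultivaluedCoV.EllipticArea.ellipticAreaIdentity_proof @ 30168c167dab (prover) · by planner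
sources: Lawden1989, KontsevichZagier2001
[support] The accessible identity behind crux 2 as a CHAIN: for g₂,g₃ ∈ ℚ with three real roots,
[ℝ², 1/|P(u+iv)|] − 2•[R, 1/√(−P(s)P(t))] ∈ KZ.relations (∬_{ℝ²} dudv/|P| =
2(∫_{e_max}^∞ds/√P)(∫_{−∞}^{e_min}dt/√(−P)) = |ω₁||ω₂|/2). Moves: ℝ² = H ∪ (closed lower
half-plane); lower = H̄ ∪ axis (null); reflection v ↦ −v (rule 2, |P(ū)| = |P(u)|) identifies [H̄]
with [H]; EllipticAreaCoV twice; integrand additivity [R,2f] = [R,f]+[R,f]. Survives even if crux 2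
fails as a ONE-move claim (then prove it by any chain). Failure would refute the summit (values
certified). -/
@[route_item "route-KontsevichZagierPeriods-MultivaluedCoV"]
def EllipticAreaIdentity : Prop :=
  ∀ g₂ g₃ : ℚ, 0 < g₂ ^ 3 - 27 * g₃ ^ 2 → ∀ (r r' : Literature.NumberTheory.Transcendental.KZ.IntegralRep 2), r.domain = Set.univ → Set.EqOn r.integrand (fun w => 1 / ‖4 * ((w 0 : ℂ) + (w 1 : ℂ) * Complex.I) ^ 3 - (g₂ : ℂ) * ((w 0 : ℂ) + (w 1 : ℂ) * Complex.I) - (g₃ : ℂ)‖) r.domain → r'.domain = {z : Fin 2 → ℝ | 0 < 4 * z 0 ^ 3 - (g₂ : ℝ) * z 0 - g₃ ∧ 0 < 12 * z 0 ^ 2 - (g₂ : ℝ) ∧ 0 < z 0 ∧ 4 * z 1 ^ 3 - (g₂ : ℝ) * z 1 - g₃ < 0 ∧ 0 < 12 * z 1 ^ 2 - (g₂ : ℝ) ∧ z 1 < 0} → Set.EqOn r'.integrand (fun z => 1 / Real.sqrt (-((4 * z 0 ^ 3 - (g₂ : ℝ) * z 0 - g₃) * (4 * z 1 ^ 3 -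 (g₂ : ℝ) * z 1 - g₃)))) r'.domain → Literature.NumberTheory.Transcendental.KZ.of r - 2 • Literature.NumberTheory.Transcendental.KZ.of r' ∈ Literature.NumberTheory.Transcendental.KZ.relations

-- `EllipticAreaIdentity` holds: proved by `Summit.KontsevichZagierPeriods.MultivaluedCoV.EllipticArea.ellipticAreaIdentity_proof` @ 30168c167dab (its module imports this route file, so no `_holds` link can be stated here).

/-- item stmt-KontsevichZagierPeriods-2879 · support · rank 9 · closed · proved by Summit.KontsevichZagierPeriods.MultivaluedCoV.TwoIsogenyAreaIdentity.twoIsogenyAreaIdentity_proof @ fd3a35a9dcea (prover) · by planner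
sources: SilvermanAEC2009, KontsevichZagier2001
[support] ∬_{ℝ²} dA/|x³+ax²+bx| = 2∬_{ℝ²} dA/|X³−2aX²+(a²−4b)X| (a,b ∈ ℚ, b(a²−4b) ≠ 0) as [r] −
2•[r'] ∈ KZ.relations: immediate from TwoIsogenySheets + SheetTransfer (N = 2). Geometric meaning:
covol(Λ_E) = 2·covol(Λ_{E'}) for the 2-isogeny z ↦ −z, Λ_E ⊂ Λ_{E'} of index 2. A new family of
accessible identities with algebraic (1/√poly over ℚ) integrands in dimension 2; certified
numerically to 2e−3. Failure would refute the summit. -/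
@[route_item "route-KontsevichZagierPeriods-MultivaluedCoV"]
def TwoIsogenyAreaIdentity : Prop :=
  ∀ a b : ℚ, b ≠ 0 → a ^ 2 - 4 * b ≠ 0 → ∀ (r r' : Literature.NumberTheory.Transcendental.KZ.IntegralRep 2), r.domain = Set.univ → Set.EqOn r.integrand (fun z => 1 / ‖((z 0 : ℂ) + (z 1 : ℂ) * Complex.I) ^ 3 + (a : ℂ) * ((z 0 : ℂ) + (z 1 : ℂ) * Complex.I) ^ 2 + (b : ℂ) * ((z 0 : ℂ) + (z 1 : ℂ) * Complex.I)‖) r.domain → r'.domain = Set.univ → Set.EqOn r'.integrand (fun w => 1 / ‖((w 0 : ℂ) + (w 1 : ℂ) * Complex.I) ^ 3 - 2 * (a : ℂ) * ((w 0 : ℂ) + (w 1 : ℂ) * Complex.I) ^ 2 + ((a : ℂ) ^ 2 - 4 * (b : ℂ)) * ((w 0 : ℂ) + (w 1 : ℂ) * Complex.I)‖) r'.domain → Literature.NumberTheory.Transcendental.KZ.of r - 2 • Literature.NumberTheory.Transcendental.KZ.of r' ∈ Literature.NumberTheory.Transcendental.KZ.relations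

-- `TwoIsogenyAreaIdentity` holds: proved by `Summit.KontsevichZagierPeriods.MultivaluedCoV.TwoIsogenyAreaIdentity.twoIsogenyAreaIdentity_proof` @ fd3a35a9dcea (its module imports this route file, so no `_holds` link can be stated here).

/-- item stmt-KontsevichZagierPeriods-2880 · support · rank 9 · closed · proved by Summit.KontsevichZagierPeriods.MultivaluedCoV.LandenIsogenyCoV.LandenIsogenyCoV_proof @ cb728440c4b4 (prover) · by planner
sources: doi:10.1007/978-1-4757-2736-4_57, Lawden1989
[support] Calibration, rung 1 in dimension 1: the Landen/Gauss AGM step (the 2-isogeny on real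
points) is ONE rule-2) instance with ALL data rational: for a,b ∈ ℚ_{>0}, Φ(t) = (t − ab/t)/2 maps
(0,∞) increasingly onto ℝ with Φ' = (t²+ab)/(2t²), and 1/√((Φ²+((a+b)/2)²)(Φ²+ab))·Φ'(t) =
2/√((t²+a²)(t²+b²)) (Newman 1985, doi:10.1007/978-1-4757-2736-4_57; identity certified to 1e−16),
i.e. [ (0,∞), 2/√((t²+a²)(t²+b²)) ] − [ ℝ, 1/√((x²+((a+b)/2)²)(x²+ab)) ] ∈ changeOfVariablesRel:
I(a,b) = I((a+b)/2, √(ab)) without irrationalities (only ((a+b)/2)² and ab occur). Known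
mathematics; filed as the cheapest prover warm-up with exactly the shape of crux 2 (explicit
algebraic Φ, InjOn, image = whole target, Jacobian identity). -/
@[route_item "route-KontsevichZagierPeriods-MultivaluedCoV"]
def LandenIsogenyCoV : Prop :=
  ∀ a b : ℚ, 0 < a → 0 < b → ∀ (r r' : Literature.NumberTheory.Transcendental.KZ.IntegralRep 1), r.domain = {x : Fin 1 → ℝ | 0 < x 0} → Set.EqOn r.integrand (fun x => 2 / Real.sqrt ((x 0 ^ 2 + (a : ℝ) ^ 2) * (x 0 ^ 2 + (b : ℝ) ^ 2))) r.domain → r'.domain = Set.univ → Set.EqOn r'.integrand (fun x => 1 / Real.sqrt ((x 0 ^ 2 + (((a : ℝ) + b) / 2) ^ 2) * (x 0 ^ 2 + (a : ℝ) * b))) r'.domain → Literature.NumberTheory.Transcendental.KZ.of r - Literature.NumberTheory.Transcendental.KZ.of r' ∈ Literature.NumberTheory.Transcendental.KZ.changeOfVariablesRel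

-- `LandenIsogenyCoV` holds: proved by `Summit.KontsevichZagierPeriods.MultivaluedCoV.LandenIsogenyCoV.LandenIsogenyCoV_proof` @ cb728440c4b4 (its module imports this route file, so no `_holds` link can be stated here).

/-- item stmt-KontsevichZagierPeriods-2874 · assembly · rank 1 · closed · proved by Summit.KontsevichZagierPeriods.MultivaluedCoV.assembly_proof @ f55395447502 (prover) · by planner
sources: KontsevichZagier2001
[assembly] SheetTransfer → MultiCoVKernel → KontsevichZagierPeriods. PROVED in the planner's
Sketch.lean (10 lines): AddSubgroup.closure_le with KZ.domainAddRel_subset_relations /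
integrandAddRel_subset_relations / newtonLeibnizRel_subset_relations and SheetTransfer for the
fourth generator set gives ker eval ≤ relations = KZKernelConjecture, then
Summit.KontsevichZagierPeriods.KernelForm.kontsevichZagierPeriods_of_kzKernelConjecture
(Theorems/KernelFormKernelImpliesStatement.lean). A prover can copy it verbatim. -/
@[route_item "route-KontsevichZagierPeriods-MultivaluedCoV"]
def Assembly : Prop :=
  SheetTransfer → MultiCoVKernel → KontsevichZagierPeriods

-- `Assembly` holds: proved by `Summit.KontsevichZagierPeriods.MultivaluedCoV.assembly_proof` @ f55395447502 (its module imports this route file, so no `_holds` link can be stated here).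

/-! D-0027 §2.1 — DECIDING THEOREM (planner-authored via `route open/edit --closes-file`; by planner-rbadge-KontsevichZagierPeriods-Multiva-cc5c3802-g2-0 2026-08-15T16:11:32Z):
its hypotheses are this route's items and its conclusion the sub-problem Statement (glue_lint), and it elaborates with this file. -/

/-- Route glue (D-0027 §2.1), pure logic. `MultiCoVKernel` puts every value-zero formal
combination in the subgroup generated by domain additivity (1a), integrand additivity (1b),
Newton–Leibniz (3) and the multivalued change-of-variables relators; `SheetTransfer` says each
such relator already lies in `KZ.relations`, and the other three generator sets are moves of the
calculus (`KZ.domainAddRel_subset_relations`, `KZ.integrandAddRel_subset_relations`,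
`KZ.newtonLeibnizRel_subset_relations`), so `AddSubgroup.closure_le` gives
`ker eval ≤ KZ.relations`; finally `r.value = r'.value` is `KZ.eval ([r] − [r']) = 0`
(`KZ.eval_of`) and `KZ.Equivalent r r'` is `[r] − [r'] ∈ KZ.relations` by definition
(the step of `Theorems/KernelFormKernelImpliesStatement.lean`, inlined). The rungs
`EllipticAreaCoV`, `TriplicationAccessible`, `TwoIsogenySheets` and the supports are
demonstrations of the engine and are not hypotheses of the deciding theorem. -/
@[closes "route-KontsevichZagierPeriods-MultivaluedCoV"] theorem closes : SheetTransfer → MultiCoVKernel → KontsevichZagierPeriods := by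
  intro hT hK n m r r' _ _ hv
  have h0 : Literature.NumberTheory.Transcendental.KZ.eval
      (Literature.NumberTheory.Transcendental.KZ.of r -
        Literature.NumberTheory.Transcendental.KZ.of r') = 0 := by
    simp [Literature.NumberTheory.Transcendental.KZ.eval_of, hv]
  have hmem := hK _ h0
  refine (AddSubgroup.closure_le _).mpr ?_ hmem
  rintro c (((hc | hc) | hc) | hc)
  · exact Literature.NumberTheory.Transcendental.KZ.domainAddRel_subset_relations hc
  · exact Literature.NumberTheory.Transcendental.KZ.integrandAddRel_subset_relations hc
  · exact Literature.NumberTheory.Transcendental.KZ.newtonLeibnizRel_subset_relations hc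
  · obtain ⟨k, N, ρ, ρ', σ, Φ, Φ', h1, h2, h3, h4, h5, h6, h7, h8, h9, rfl⟩ := hc
    exact hT k N ρ ρ' σ Φ Φ' h1 h2 h3 h4 h5 h6 h7 h8 h9

end Summit.KontsevichZagierPeriods.KontsevichZagierPeriods.Theses.MultivaluedCoV
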